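import Literature.NumberTheory.GaloisRepresentations.RestrictedRamificationOpenSubgroupLayersRelative
import Literature.NumberTheory.GaloisRepresentations.SUnitsRestrictedLayers
import Literature.NumberTheory.GaloisRepresentations.SUnitsLayerInvariantVector
import Literature.NumberTheory.GaloisRepresentations.ContinuousShapiroOpenCoinducedLayerShapiro
import HarnessLib

/-!
# The layers of `E_S` on `W = Gal(K_S/E) ≤ U` ARE the `Gal(E′/E)`-modules `𝒪_{E′,S}ˣ`:
# `Hⁿ(W⧸V, (E_S)^V) ≅ Hⁿ(Gal(E′/E), 𝒪_{E′,S}ˣ)`, conjugation by `U⧸V` ↦ Serre's `σ_t`, transitions ↦ inflation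
# (NSW VIII §3, (1.5.1); Serre, *Local Fields* VII §5; *Cohomologie galoisienne* I §2.2 Prop. 8)

Topic `NumberTheory/GaloisRepresentations`; namespace
`Literature.NumberTheory.GaloisRepresentations.SUnits.Layers`.  Sequel of `SUnitsRestrictedLayers` ((A2-β2):
`layerRep`, `layerModuleEquiv`, `layerModuleEquiv_comm` — the layers of `E_S|_U` over the FULL quotients
`U ⧸ Gal(K_S/E′) ≃ Gal(E′/F₀)`), of `RestrictedRamificationOpenSubgroupLayersRelative` (G1 file 1:
`relEquiv : W̄ ≃* Gal(E′/E)` for `W̄ = Gal(K_S/E)⧸Gal(K_S/E′) ≤ U⧸Gal(K_S/E′)`, cofinality of the layer traces in `W`), of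
`SUnitsLayerInvariantVector` (`sUnitsConj F₀ F E S t n`, Serre's `σ_t`; `SUnitsLayerInflation.layerInf`) and of
`ContinuousShapiroOpenCoinduced{LayerModule,LayerShapiro}` (the `Δ = U⧸W`-module `Hⁿ_cont(U, Maps(Δ, E_S))` read on the
layers through `Hⁿ(W̄, (E_S)^V)` with `conjRepCohomology W̄ _`, and through the `↥W`-layers `Hⁿ(↥W ⧸ (V ∩ W), (E_S|_W)^{V∩W})`
via `traceQuotMapRange`/`traceLayerHomRange`).  Definitions with bodies (a group isomorphism, a linear equivalence and
two `groupCohomology.mapIso`s — plumbing) and theorems; NO named fact, no `sorry`, no instance, no notation.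

SETTING AND SPELLING.  `K` a number field, `S` a set of finite places, `H ≤ Γ_K` open, `U := galoisGroupAbove S H` with a
`CompactSpace` instance in scope (`Layers.compactSpace_above`; the spelling of -w2 g9's files), `F₀ := baseField H`,
`M := resD K S H hHo` ((A2-β2): `E_S|_U` in door-c4's `C_U`, = `stdBase (resRep K S H).toTopRep _` by `resD_eq`/`rfl`, the
spelling of -w2 g9's instantiated statements — bridge by `exact`/`show`, i.e. default-transparency unfolding of `resD`), layers `E ≤ E′` with `hF : F₀ ≤ E`, `hS`, `hS′`, `W := layerSubgroup S hHo E hF hS` (as a `Subgroup ↥U`),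
`V := layerSubgroup S hHo E′ (hF.trans hEE′) hS′`, `W̄ := W.map (mk' V)`, `X_V := (invariantsQuotFunctor ℤ V).obj M`
(= `layerRep hHo E′ _ hS′`), `M_W := (resD ℤ W).obj M` (`E_S|_W` in `C_W`), `Y_V := (invariantsQuotFunctor ℤ (V ∩ W)).obj M_W`
(the `↥W`-layer at the trace `traceOpenNormalSubgroup W V`), inclusion algebras `algOfLE` (`F₀ → E → E′`),
`t := layerEquiv E′ g ∈ Gal(E′/F₀)` for `g ∈ U ⧸ V`; `κ := ContinuousRep.traceQuotMapRange W V` (-w2) and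
`λ′ := traceLayerHom' …` (the identity-on-vectors layer morphism `Res_κ (Res_{W̄} X_V) ⟶ Y_V`; it is -w2's
`(resRep K S H).traceLayerHomRange W V` with `M` spelled `resD K S H hHo` — same function, `rfl` on vectors).

* §1 `sUnitsRep_ρ_relEquiv`: `Gal(E′/E)` acts on `𝒪_{E′,S}ˣ` through `Gal(E′/F₀)`.
* §2 **`relLayerCohomologyIso … n : Hⁿ(W̄, X_V) ≅ Hⁿ(Gal(E′/E), sUnitsRep K S E E′)`** (`J`; Mathlib `mapIso` along `relEquiv` and
  `layerModuleEquiv`) and **`relLayerCohomologyIso_hom_conjRepCohomology`**: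
  `J (conjRepCohomology W̄ X_V n g z) = sUnitsConj F₀ E E′ S (layerEquiv E′ g) n (J z)` — the conjugation action of `U ⧸ V` on
  `Hⁿ(W̄, X_V)` (the right-hand token of -w2's `coindOpenHRep_layer_conj` (2)) IS Serre's `σ_t` (the `S`-unit twin of -w3's
  `resIdeleRepIsoOfEquiv_conjRepCohomology`).
* §3 the `↥W`-layers: `traceEquiv : ↥W ⧸ (V ∩ W) ≃* Gal(E′/E)`, `traceLayerModuleEquiv : Y_V.V ≃ₗ[ℤ] X_V.V` (door-c4's
  `traceLayerHom`, inverted), **`traceLayerCohomologyIso … n : Hⁿ(↥W ⧸ (V ∩ W), Y_V) ≅ Hⁿ(Gal(E′/E), sUnitsRep K S E E′)`** (`J′`),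
  **`traceLayerCohomologyIso_hom_map_traceQuotMapRange`** (`J′ ∘ Hⁿ(κ, λ′) = J` for -w2's `κ = traceQuotMapRange` and the
  identity-on-vectors `λ′ = traceLayerHom'`), and **`traceLayerCohomologyIso_hom_stepG`**: door-c4's transition `stepG (V′ ∩ W) (V″ ∩ W)` of the
  `↥W`-system IS `SUnits.Layers.layerInf` — the `compat` field of `LayerColimit.IsCompatibleFamily` (whose `cofinal` field is
  file 1's `exists_layer_traceOpenNormalSubgroup_le`).

Lane «TATE-EPC-TC» of cell `bsd-eis` (crux `GoodLatticeBDPValue`, stmt-BirchSwinnertonDyer-19032), piece G1, file 2 of 3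
(cohomology side).  HONEST FRAMING: homological bookkeeping only; no statement of a Summit, of Tate's theorem or of the crux
is proved here; 0 cells / labels / tiers move.

## References
* J. Neukirch, A. Schmidt, K. Wingberg, *Cohomology of Number Fields*, 2nd ed. (2008), VIII §3, (1.5.1), I §6.
  [NeukirchSchmidtWingberg2008]
* J.-P. Serre, *Local Fields*, GTM 67 (1979), Ch. VII §5. [SerreLocalFields1979]
* J.-P. Serre, *Cohomologie galoisienne* (1994), I §2.2 Prop. 8. [SerreGaloisCohomology1997]
* K. S. Brown, *Cohomology of Groups* (1982), III (8.3). [Brown1982CohomologyGroups]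
-/

noncomputable section

open NumberField IsDedekindDomain Field Topology CategoryTheory groupCohomology
open Literature.NumberTheory.GaloisRepresentations.IdeleClassBar (GalLayer)
open Literature.NumberTheory.GaloisRepresentations.LocalWeilDatum (galFixing)
open Literature.NumberTheory.IwasawaTheory.Greenberg2006 (galoisGroupAbove)
open Literature.NumberTheory.GaloisRepresentations.OpenSubgroupLayer (algOfLE isScalarTower_algOfLE baseField
  layerEquiv relEquiv restrictScalars_relEquiv layerEquiv_relEquiv_symm layerSubgroup_le_of_le
  toAbove toAbove_surjective coe_layerEquiv_mk_eq_of_le)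
open Literature.Algebra.Homology Literature.Algebra.Homology.DiscreteRep
open Literature.Algebra.Homology.DiscreteRep.LayerColimit (stepG)

namespace Literature.NumberTheory.GaloisRepresentations

namespace SUnits

namespace Layers

variable {K : Type} [Field K] [NumberField K] {S : Set (HeightOneSpectrum (𝓞 K))}
  {H : Subgroup (absoluteGaloisGroup K)} (hHo : IsOpen (H : Set (absoluteGaloisGroup K)))
  {E E' : GalLayer K} (hEE' : E ≤ E') (hF : baseField H ≤ E.1)
  (hS : ramificationSubgroup K S ≤ galFixing K E.1) (hS' : ramificationSubgroup K S ≤ galFixing K E'.1)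

/-! ### §1. `Gal(E′/E)` acts on `𝒪_{E′,S}ˣ` through `Gal(E′/F₀)` -/

/-- **`(sUnitsRep K S E E′).ρ (relEquiv n) = (sUnitsRep K S F₀ E′).ρ (layerEquiv E′ n)`**: the same automorphism of `E′`
acting on the same units. [cite: NeukirchSchmidtWingberg2008, VIII §3] -/
theorem sUnitsRep_ρ_relEquiv
    (n : ↥(((OpenSubgroupLayer.layerSubgroup S hHo E hF hS : OpenNormalSubgroup ↥(galoisGroupAbove S H)) :
        Subgroup ↥(galoisGroupAbove S H)).map
        (QuotientGroup.mk' ((OpenSubgroupLayer.layerSubgroup S hHo E' (hF.trans hEE') hS') : Subgroup ↥(galoisGroupAbove S H))))) :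
    letI := algOfLE hF
    letI := algOfLE (show E.1 ≤ E'.1 from hEE')
    letI := algOfLE (hF.trans hEE')
    haveI := isScalarTower_algOfLE (K := K) (show E.1 ≤ E'.1 from hEE')
    haveI := isScalarTower_algOfLE (K := K) (hF.trans hEE')
    (sUnitsRep K S ↥E.1 ↥E'.1).ρ (relEquiv S hHo hEE' hF hS hS' n) =
      (sUnitsRep K S ↥(baseField H) ↥E'.1).ρ (layerEquiv S hHo E' (hF.trans hEE') hS' n.1) := by
  letI := algOfLE hF
  letI := algOfLE (show E.1 ≤ E'.1 from hEE')
  letI := algOfLE (hF.trans hEE')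
  haveI := isScalarTower_algOfLE (K := K) (show E.1 ≤ E'.1 from hEE')
  haveI := isScalarTower_algOfLE (K := K) (hF.trans hEE')
  refine LinearMap.ext fun x => ?_
  apply (Additive.toMul (α := sUnits K S ↥E'.1)).injective
  exact Subtype.ext (Units.ext rfl)

/-! ### §2. `J : Hⁿ(W̄, X_V) ≅ Hⁿ(Gal(E′/E), 𝒪_{E′,S}ˣ)` and the conjugation dictionary -/

/-- The equivariance hypothesis of `mapIso` for `J`: `layerModuleEquiv ∘ (n • ·) = (relEquiv n • ·) ∘ layerModuleEquiv` on
`(E_S|_U)^V`, `n ∈ W̄` ((A2-β2) `layerModuleEquiv_comm` + §1). [cite: NeukirchSchmidtWingberg2008, VIII §3] -/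
theorem layerModuleEquiv_comm_relEquiv
    (g : ↥(((OpenSubgroupLayer.layerSubgroup S hHo E hF hS : OpenNormalSubgroup ↥(galoisGroupAbove S H)) :
        Subgroup ↥(galoisGroupAbove S H)).map
        (QuotientGroup.mk' ((OpenSubgroupLayer.layerSubgroup S hHo E' (hF.trans hEE') hS') : Subgroup ↥(galoisGroupAbove S H))))) :
    letI := algOfLE hF
    letI := algOfLE (show E.1 ≤ E'.1 from hEE')
    letI := algOfLE (hF.trans hEE')
    haveI := isScalarTower_algOfLE (K := K) (show E.1 ≤ E'.1 from hEE')
    haveI := isScalarTower_algOfLE (K := K) (hF.trans hEE')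
    (layerModuleEquiv hHo E' (hF.trans hEE') hS').toLinearMap ∘ₗ
        (_root_.Literature.Algebra.Homology.resSub
          (((OpenSubgroupLayer.layerSubgroup S hHo E hF hS : OpenNormalSubgroup ↥(galoisGroupAbove S H)) :
        Subgroup ↥(galoisGroupAbove S H)).map
        (QuotientGroup.mk' ((OpenSubgroupLayer.layerSubgroup S hHo E' (hF.trans hEE') hS') : Subgroup ↥(galoisGroupAbove S H))))
          (layerRep hHo E' (hF.trans hEE') hS')).ρ g =
      (sUnitsRep K S ↥E.1 ↥E'.1).ρ (relEquiv S hHo hEE' hF hS hS' g) ∘ₗ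
        (layerModuleEquiv hHo E' (hF.trans hEE') hS').toLinearMap := by
  letI := algOfLE hF
  letI := algOfLE (show E.1 ≤ E'.1 from hEE')
  letI := algOfLE (hF.trans hEE')
  haveI := isScalarTower_algOfLE (K := K) (show E.1 ≤ E'.1 from hEE')
  haveI := isScalarTower_algOfLE (K := K) (hF.trans hEE')
  rw [sUnitsRep_ρ_relEquiv hHo hEE' hF hS hS' g]
  exact layerModuleEquiv_comm hHo E' (hF.trans hEE') hS' g.1

/-- **`J : Hⁿ(W̄, (E_S|_U)^V) ≅ Hⁿ(Gal(E′/E), 𝒪_{E′,S}ˣ)`** (Mathlib `groupCohomology.mapIso` along file 1's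
`relEquiv : W̄ ≃* Gal(E′/E)` and (A2-β2)'s `layerModuleEquiv : ((E_S|_U)^V).V ≃ₗ[ℤ] Additive 𝒪_{E′,S}ˣ`).  The source is the
module of -w2's `conjRepCohomology (W.map (mk' V)) X_V n` at `ρ := resRep K S H` (with `X_V` spelled `layerRep`, `resD_eq`).
[cite: NeukirchSchmidtWingberg2008, VIII §3, (1.5.1)] [cite: SerreGaloisCohomology1997, I §2.2 Prop. 8] -/
def relLayerCohomologyIso (n : ℕ) :
    letI := algOfLE (show E.1 ≤ E'.1 from hEE')
    haveI := isScalarTower_algOfLE (K := K) (show E.1 ≤ E'.1 from hEE')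
    groupCohomology (_root_.Literature.Algebra.Homology.resSub
      (((OpenSubgroupLayer.layerSubgroup S hHo E hF hS : OpenNormalSubgroup ↥(galoisGroupAbove S H)) :
        Subgroup ↥(galoisGroupAbove S H)).map
        (QuotientGroup.mk' ((OpenSubgroupLayer.layerSubgroup S hHo E' (hF.trans hEE') hS') : Subgroup ↥(galoisGroupAbove S H))))
      (layerRep hHo E' (hF.trans hEE') hS')) n ≅
      groupCohomology (sUnitsRep K S ↥E.1 ↥E'.1) n :=
  letI := algOfLE hF
  letI := algOfLE (show E.1 ≤ E'.1 from hEE')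
  letI := algOfLE (hF.trans hEE')
  haveI := isScalarTower_algOfLE (K := K) (show E.1 ≤ E'.1 from hEE')
  haveI := isScalarTower_algOfLE (K := K) (hF.trans hEE')
  groupCohomology.mapIso (relEquiv S hHo hEE' hF hS hS') (layerModuleEquiv hHo E' (hF.trans hEE') hS')
    (layerModuleEquiv_comm_relEquiv hHo hEE' hF hS hS') n

/-- The morphism of pairs `(Gal(E′/E), 𝒪_{E′,S}ˣ) → (W̄, (E_S|_U)^V)` behind `J`: `layerModuleEquiv` as a morphism
`Res_{relEquiv⁻¹} (Res_{W̄} X_V) ⟶ sUnitsRep K S E E′`. [cite: NeukirchSchmidtWingberg2008, VIII §3] -/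
def relLayerPairHom :
    letI := algOfLE (show E.1 ≤ E'.1 from hEE')
    haveI := isScalarTower_algOfLE (K := K) (show E.1 ≤ E'.1 from hEE')
    Rep.res ((relEquiv S hHo hEE' hF hS hS').symm : (E'.1 ≃ₐ[E.1] E'.1) →* ↥(((OpenSubgroupLayer.layerSubgroup S hHo E hF hS : OpenNormalSubgroup ↥(galoisGroupAbove S H)) :
        Subgroup ↥(galoisGroupAbove S H)).map
        (QuotientGroup.mk' ((OpenSubgroupLayer.layerSubgroup S hHo E' (hF.trans hEE') hS') : Subgroup ↥(galoisGroupAbove S H)))))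
        (_root_.Literature.Algebra.Homology.resSub
          (((OpenSubgroupLayer.layerSubgroup S hHo E hF hS : OpenNormalSubgroup ↥(galoisGroupAbove S H)) :
        Subgroup ↥(galoisGroupAbove S H)).map
        (QuotientGroup.mk' ((OpenSubgroupLayer.layerSubgroup S hHo E' (hF.trans hEE') hS') : Subgroup ↥(galoisGroupAbove S H))))
          (layerRep hHo E' (hF.trans hEE') hS')) ⟶
      sUnitsRep K S ↥E.1 ↥E'.1 :=
  letI := algOfLE hF
  letI := algOfLE (show E.1 ≤ E'.1 from hEE')
  letI := algOfLE (hF.trans hEE')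
  haveI := isScalarTower_algOfLE (K := K) (show E.1 ≤ E'.1 from hEE')
  haveI := isScalarTower_algOfLE (K := K) (hF.trans hEE')
  Rep.ofHom ⟨(layerModuleEquiv hHo E' (hF.trans hEE') hS').toLinearMap, fun h => by
    have he := layerModuleEquiv_comm_relEquiv hHo hEE' hF hS hS' ((relEquiv S hHo hEE' hF hS hS').symm h)
    rwa [MulEquiv.apply_symm_apply] at he⟩

/-- `J.hom = Hⁿ(relEquiv⁻¹, relLayerPairHom)` (unfolding `mapIso`). [cite: NeukirchSchmidtWingberg2008, VIII §3] -/
theorem relLayerCohomologyIso_hom_eq (n : ℕ) :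
    letI := algOfLE (show E.1 ≤ E'.1 from hEE')
    haveI := isScalarTower_algOfLE (K := K) (show E.1 ≤ E'.1 from hEE')
    (relLayerCohomologyIso hHo hEE' hF hS hS' n).hom =
      groupCohomology.map ((relEquiv S hHo hEE' hF hS hS').symm : (E'.1 ≃ₐ[E.1] E'.1) →* ↥(((OpenSubgroupLayer.layerSubgroup S hHo E hF hS : OpenNormalSubgroup ↥(galoisGroupAbove S H)) :
        Subgroup ↥(galoisGroupAbove S H)).map
        (QuotientGroup.mk' ((OpenSubgroupLayer.layerSubgroup S hHo E' (hF.trans hEE') hS') : Subgroup ↥(galoisGroupAbove S H)))))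
        (relLayerPairHom hHo hEE' hF hS hS') n :=
  rfl

/-- **The conjugation square**: `Hⁿ(c_g, ρ(g)) ≫ J = J ≫ σ_{layerEquiv E′ g}` for `g ∈ U ⧸ V` (both composites are
`Hⁿ` of one morphism of pairs; the group maps agree in `Gal(E′/F₀)` through `layerEquiv E′`, the module maps by
`layerModuleEquiv_comm`). [cite: SerreLocalFields1979, Ch. VII §5] [cite: Brown1982CohomologyGroups, III (8.3)] -/
theorem map_subgroupConj_comp_relLayerCohomologyIso_hom (n : ℕ)
    (g : ↥(galoisGroupAbove S H) ⧸ ((OpenSubgroupLayer.layerSubgroup S hHo E' (hF.trans hEE') hS') : Subgroup ↥(galoisGroupAbove S H))) :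
    letI := algOfLE hF
    letI := algOfLE (show E.1 ≤ E'.1 from hEE')
    letI := algOfLE (hF.trans hEE')
    haveI := isScalarTower_algOfLE (K := K) (show E.1 ≤ E'.1 from hEE')
    haveI := isScalarTower_algOfLE (K := K) (hF.trans hEE')
    haveI := isScalarTower_algOfLE₃ hF (show E.1 ≤ E'.1 from hEE')
    haveI := E.isGalois
    haveI := normal_algOfLE (K := K) hF
    groupCohomology.map (subgroupConj _ g (conj_mem_of_normal _ g))
          (resConj
            (((OpenSubgroupLayer.layerSubgroup S hHo E hF hS : OpenNormalSubgroup ↥(galoisGroupAbove S H)) :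
        Subgroup ↥(galoisGroupAbove S H)).map
        (QuotientGroup.mk' ((OpenSubgroupLayer.layerSubgroup S hHo E' (hF.trans hEE') hS') : Subgroup ↥(galoisGroupAbove S H))))
            (layerRep hHo E' (hF.trans hEE') hS') g (conj_mem_of_normal _ g)) n ≫
        (relLayerCohomologyIso hHo hEE' hF hS hS' n).hom =
      (relLayerCohomologyIso hHo hEE' hF hS hS' n).hom ≫
        sUnitsConj ↥(baseField H) ↥E.1 ↥E'.1 S (layerEquiv S hHo E' (hF.trans hEE') hS' g) n := by
  letI := algOfLE hF
  letI := algOfLE (show E.1 ≤ E'.1 from hEE')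
  letI := algOfLE (hF.trans hEE')
  haveI := isScalarTower_algOfLE (K := K) (show E.1 ≤ E'.1 from hEE')
  haveI := isScalarTower_algOfLE (K := K) (hF.trans hEE')
  haveI := isScalarTower_algOfLE₃ hF (show E.1 ≤ E'.1 from hEE')
  haveI := E.isGalois
  haveI := normal_algOfLE (K := K) hF
  rw [relLayerCohomologyIso_hom_eq, sUnitsConj, ← groupCohomology.map_comp, ← groupCohomology.map_comp]
  refine map_congr' ?_ _ _ (fun x => ?_) n
  · -- the group homomorphisms `Gal(E′/E) → W̄` agree: compare in `Gal(E′/F₀)` through `layerEquiv E′`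
    refine MonoidHom.ext fun σ => Subtype.ext ?_
    apply (layerEquiv S hHo E' (hF.trans hEE') hS').injective
    simp only [MonoidHom.comp_apply, MonoidHom.coe_coe, coe_subgroupConj_apply, map_mul, map_inv]
    rw [layerEquiv_relEquiv_symm S hHo hEE' hF hS hS', layerEquiv_relEquiv_symm S hHo hEE' hF hS hS',
      IdeleCohomology.restrictScalars_galConjOver]
  · -- the module maps agree: `layerModuleEquiv (g x) = t • layerModuleEquiv x`
    exact LinearMap.congr_fun (layerModuleEquiv_comm hHo E' (hF.trans hEE') hS' g) x

/-- **THE CONJUGATION DICTIONARY: `J (conjRepCohomology W̄ X_V n g z) = σ_{layerEquiv E′ g} (J z)`** — under `J` the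
conjugation action of `g ∈ U ⧸ V` on `Hⁿ(W̄, (E_S|_U)^V)` (tree `conjRepCohomology`; the reading of the right-translation
`Δ`-action `coindOpenHRep` on layer representatives, -w2's `coindOpenHRep_layer_conj` (2) at `ρ := resRep K S H`) is Serre's
`σ_t = sUnitsConj F₀ E E′ S t n` on `Hⁿ(Gal(E′/E), 𝒪_{E′,S}ˣ)`, `t = layerEquiv E′ g ∈ Gal(E′/F₀)` (both are
`Hⁿ(h ↦ t⁻¹ h t, u ↦ t u)`). [cite: SerreLocalFields1979, Ch. VII §5] [cite: Brown1982CohomologyGroups, III (8.3)]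
[cite: NeukirchSchmidtWingberg2008, (1.5.1)] -/
theorem relLayerCohomologyIso_hom_conjRepCohomology (n : ℕ)
    (g : ↥(galoisGroupAbove S H) ⧸ ((OpenSubgroupLayer.layerSubgroup S hHo E' (hF.trans hEE') hS') : Subgroup ↥(galoisGroupAbove S H)))
    (z : groupCohomology (_root_.Literature.Algebra.Homology.resSub
      (((OpenSubgroupLayer.layerSubgroup S hHo E hF hS : OpenNormalSubgroup ↥(galoisGroupAbove S H)) :
        Subgroup ↥(galoisGroupAbove S H)).map
        (QuotientGroup.mk' ((OpenSubgroupLayer.layerSubgroup S hHo E' (hF.trans hEE') hS') : Subgroup ↥(galoisGroupAbove S H))))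
      (layerRep hHo E' (hF.trans hEE') hS')) n) :
    letI := algOfLE hF
    letI := algOfLE (show E.1 ≤ E'.1 from hEE')
    letI := algOfLE (hF.trans hEE')
    haveI := isScalarTower_algOfLE (K := K) (show E.1 ≤ E'.1 from hEE')
    haveI := isScalarTower_algOfLE (K := K) (hF.trans hEE')
    haveI := isScalarTower_algOfLE₃ hF (show E.1 ≤ E'.1 from hEE')
    haveI := E.isGalois
    haveI := normal_algOfLE (K := K) hF
    (relLayerCohomologyIso hHo hEE' hF hS hS' n).hom.hom
        (conjRepCohomology
          (((OpenSubgroupLayer.layerSubgroup S hHo E hF hS : OpenNormalSubgroup ↥(galoisGroupAbove S H)) :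
        Subgroup ↥(galoisGroupAbove S H)).map
        (QuotientGroup.mk' ((OpenSubgroupLayer.layerSubgroup S hHo E' (hF.trans hEE') hS') : Subgroup ↥(galoisGroupAbove S H))))
          (layerRep hHo E' (hF.trans hEE') hS') n g z) =
      sUnitsConj ↥(baseField H) ↥E.1 ↥E'.1 S (layerEquiv S hHo E' (hF.trans hEE') hS' g) n
        ((relLayerCohomologyIso hHo hEE' hF hS hS' n).hom.hom z) := by
  letI := algOfLE hF
  letI := algOfLE (show E.1 ≤ E'.1 from hEE')
  letI := algOfLE (hF.trans hEE')
  haveI := isScalarTower_algOfLE (K := K) (show E.1 ≤ E'.1 from hEE')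
  haveI := isScalarTower_algOfLE (K := K) (hF.trans hEE')
  haveI := isScalarTower_algOfLE₃ hF (show E.1 ≤ E'.1 from hEE')
  haveI := E.isGalois
  haveI := normal_algOfLE (K := K) hF
  have h := congrArg (fun φ => φ.hom z) (map_subgroupConj_comp_relLayerCohomologyIso_hom hHo hEE' hF hS hS' n g)
  simpa only [ModuleCat.hom_comp, LinearMap.comp_apply, conjRepCohomology_apply] using h

/-! ### §3. The `↥W`-layers `Y_V = (E_S|_W)^{V ∩ W}`: `Hⁿ(↥W ⧸ (V ∩ W), Y_V) ≅ Hⁿ(Gal(E′/E), 𝒪_{E′,S}ˣ)` -/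

/-- **`↥W ⧸ (V ∩ W) ≃* Gal(E′/E)`**: file 1's `relEquiv` after door-c4's `traceQuotMap W V : ↥W ⧸ (V ∩ W) →* U ⧸ V`
co-restricted to `W̄` (= -w2's `κ = traceQuotMapRange`; bijective for `V ≤ W`). [cite: SerreGaloisCohomology1997, I §2.2 Prop. 8]
[cite: NeukirchSchmidtWingberg2008, (1.5.1)] -/
def traceEquiv :
    letI := algOfLE (show E.1 ≤ E'.1 from hEE')
    ↥((OpenSubgroupLayer.layerSubgroup S hHo E hF hS : OpenNormalSubgroup ↥(galoisGroupAbove S H)) :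
        Subgroup ↥(galoisGroupAbove S H)) ⧸
        (traceOpenNormalSubgroup
          ((OpenSubgroupLayer.layerSubgroup S hHo E hF hS : OpenNormalSubgroup ↥(galoisGroupAbove S H)) :
        Subgroup ↥(galoisGroupAbove S H))
          (OpenSubgroupLayer.layerSubgroup S hHo E' (hF.trans hEE') hS') :
          Subgroup ↥((OpenSubgroupLayer.layerSubgroup S hHo E hF hS : OpenNormalSubgroup ↥(galoisGroupAbove S H)) :
        Subgroup ↥(galoisGroupAbove S H))) ≃* (E'.1 ≃ₐ[E.1] E'.1) :=
  letI := algOfLE (show E.1 ≤ E'.1 from hEE')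
  MulEquiv.ofBijective
    ((relEquiv S hHo hEE' hF hS hS').toMonoidHom.comp
      (ContinuousRep.traceQuotMapRange
        ((OpenSubgroupLayer.layerSubgroup S hHo E hF hS : OpenNormalSubgroup ↥(galoisGroupAbove S H)) :
        Subgroup ↥(galoisGroupAbove S H))
        (OpenSubgroupLayer.layerSubgroup S hHo E' (hF.trans hEE') hS')))
    (by
      refine (relEquiv S hHo hEE' hF hS hS').bijective.comp ⟨fun a b h => ?_, fun m => ?_⟩
      · exact traceQuotMap_injective _ _ (congrArg Subtype.val h)
      · obtain ⟨u, hu, hm⟩ := m.2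
        exact ⟨QuotientGroup.mk ⟨u, hu⟩, Subtype.ext hm⟩)

/-- Formula: `traceEquiv [w] y = layerEquiv E′ [w] y`. [cite: NeukirchSchmidtWingberg2008, VIII §3] -/
theorem traceEquiv_mk_apply
    (w : ↥((OpenSubgroupLayer.layerSubgroup S hHo E hF hS : OpenNormalSubgroup ↥(galoisGroupAbove S H)) :
        Subgroup ↥(galoisGroupAbove S H))) (y : E'.1) :
    letI := algOfLE (show E.1 ≤ E'.1 from hEE')
    letI := algOfLE (hF.trans hEE')
    traceEquiv hHo hEE' hF hS hS' (QuotientGroup.mk w) y =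
      layerEquiv S hHo E' (hF.trans hEE') hS' (QuotientGroup.mk (w : ↥(galoisGroupAbove S H))) y := rfl

/-- `relEquiv⁻¹ (traceEquiv [w]) = [w] ∈ W̄`. [cite: NeukirchSchmidtWingberg2008, (1.5.1)] -/
theorem relEquiv_symm_traceEquiv_mk
    (w : ↥((OpenSubgroupLayer.layerSubgroup S hHo E hF hS : OpenNormalSubgroup ↥(galoisGroupAbove S H)) :
        Subgroup ↥(galoisGroupAbove S H))) :
    letI := algOfLE (show E.1 ≤ E'.1 from hEE')
    ((relEquiv S hHo hEE' hF hS hS').symm (traceEquiv hHo hEE' hF hS hS' (QuotientGroup.mk w))).1 =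
      QuotientGroup.mk (w : ↥(galoisGroupAbove S H)) := by
  letI := algOfLE (show E.1 ≤ E'.1 from hEE')
  have h : (relEquiv S hHo hEE' hF hS hS').symm (traceEquiv hHo hEE' hF hS hS' (QuotientGroup.mk w)) =
      ⟨QuotientGroup.mk (w : ↥(galoisGroupAbove S H)),
        (OpenSubgroupLayer.mk_mem_map_layerSubgroup_iff S hHo hEE' hF hS hS' _).2 w.2⟩ :=
    (MulEquiv.symm_apply_eq _).2 rfl
  rw [h]

/-- `(traceEquiv [w])|_{F₀} = layerEquiv E′ [w]`. [cite: NeukirchSchmidtWingberg2008, (1.5.1)] -/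
theorem restrictScalars_traceEquiv_mk
    (w : ↥((OpenSubgroupLayer.layerSubgroup S hHo E hF hS : OpenNormalSubgroup ↥(galoisGroupAbove S H)) :
        Subgroup ↥(galoisGroupAbove S H))) :
    letI := algOfLE hF
    letI := algOfLE (show E.1 ≤ E'.1 from hEE')
    letI := algOfLE (hF.trans hEE')
    haveI := isScalarTower_algOfLE₃ hF (show E.1 ≤ E'.1 from hEE')
    (traceEquiv hHo hEE' hF hS hS' (QuotientGroup.mk w)).restrictScalars (baseField H) =
      layerEquiv S hHo E' (hF.trans hEE') hS' (QuotientGroup.mk (w : ↥(galoisGroupAbove S H))) := by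
  letI := algOfLE hF
  letI := algOfLE (show E.1 ≤ E'.1 from hEE')
  letI := algOfLE (hF.trans hEE')
  haveI := isScalarTower_algOfLE₃ hF (show E.1 ≤ E'.1 from hEE')
  exact AlgEquiv.ext fun _ => rfl

/-- `(sUnitsRep K S E E′).ρ (traceEquiv [w]) = (sUnitsRep K S F₀ E′).ρ (layerEquiv E′ [w])` (the same automorphism of `E′`).
[cite: NeukirchSchmidtWingberg2008, VIII §3] -/
theorem sUnitsRep_ρ_traceEquiv_mk
    (w : ↥((OpenSubgroupLayer.layerSubgroup S hHo E hF hS : OpenNormalSubgroup ↥(galoisGroupAbove S H)) :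
        Subgroup ↥(galoisGroupAbove S H))) :
    letI := algOfLE hF
    letI := algOfLE (show E.1 ≤ E'.1 from hEE')
    letI := algOfLE (hF.trans hEE')
    haveI := isScalarTower_algOfLE (K := K) (show E.1 ≤ E'.1 from hEE')
    haveI := isScalarTower_algOfLE (K := K) (hF.trans hEE')
    (sUnitsRep K S ↥E.1 ↥E'.1).ρ (traceEquiv hHo hEE' hF hS hS' (QuotientGroup.mk w)) =
      (sUnitsRep K S ↥(baseField H) ↥E'.1).ρ
        (layerEquiv S hHo E' (hF.trans hEE') hS' (QuotientGroup.mk (w : ↥(galoisGroupAbove S H)))) := by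
  letI := algOfLE hF
  letI := algOfLE (show E.1 ≤ E'.1 from hEE')
  letI := algOfLE (hF.trans hEE')
  haveI := isScalarTower_algOfLE (K := K) (show E.1 ≤ E'.1 from hEE')
  haveI := isScalarTower_algOfLE (K := K) (hF.trans hEE')
  refine LinearMap.ext fun x => ?_
  apply (Additive.toMul (α := sUnits K S ↥E'.1)).injective
  exact Subtype.ext (Units.ext rfl)

/-- **`λ′ : Res_κ (Res_{W̄} X_V) ⟶ Y_V`**, the identity on vectors (a `V`-invariant vector of `E_S` is `V ∩ W`-invariant) —
-w2 g9's `traceLayerHomRange` with `M` spelled `resD K S H hHo`. [cite: SerreGaloisCohomology1997, I §2.2 Prop. 8] -/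
def traceLayerHom' :
    Rep.res
        (ContinuousRep.traceQuotMapRange
          ((OpenSubgroupLayer.layerSubgroup S hHo E hF hS : OpenNormalSubgroup ↥(galoisGroupAbove S H)) :
        Subgroup ↥(galoisGroupAbove S H))
          (OpenSubgroupLayer.layerSubgroup S hHo E' (hF.trans hEE') hS'))
        (_root_.Literature.Algebra.Homology.resSub
          (((OpenSubgroupLayer.layerSubgroup S hHo E hF hS : OpenNormalSubgroup ↥(galoisGroupAbove S H)) :
        Subgroup ↥(galoisGroupAbove S H)).map
        (QuotientGroup.mk' ((OpenSubgroupLayer.layerSubgroup S hHo E' (hF.trans hEE') hS') : Subgroup ↥(galoisGroupAbove S H))))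
          (layerRep hHo E' (hF.trans hEE') hS')) ⟶
      ((invariantsQuotFunctor ℤ
        (traceOpenNormalSubgroup
          ((OpenSubgroupLayer.layerSubgroup S hHo E hF hS : OpenNormalSubgroup ↥(galoisGroupAbove S H)) :
        Subgroup ↥(galoisGroupAbove S H))
          (OpenSubgroupLayer.layerSubgroup S hHo E' (hF.trans hEE') hS') :
          Subgroup ↥((OpenSubgroupLayer.layerSubgroup S hHo E hF hS : OpenNormalSubgroup ↥(galoisGroupAbove S H)) :
        Subgroup ↥(galoisGroupAbove S H)))).obj
      ((DiscreteRep.resD ℤ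
        ((OpenSubgroupLayer.layerSubgroup S hHo E hF hS : OpenNormalSubgroup ↥(galoisGroupAbove S H)) :
        Subgroup ↥(galoisGroupAbove S H))).obj
      (resD K S H hHo))) :=
  Rep.ofHom
    ⟨{ toFun := fun x => ⟨x.1, mem_invariants_traceLayer
          ((OpenSubgroupLayer.layerSubgroup S hHo E hF hS : OpenNormalSubgroup ↥(galoisGroupAbove S H)) :
        Subgroup ↥(galoisGroupAbove S H))
          (OpenSubgroupLayer.layerSubgroup S hHo E' (hF.trans hEE') hS') (resD K S H hHo) x.1 x.2⟩
       map_add' := fun _ _ => rfl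
       map_smul' := fun _ _ => rfl },
     fun q => QuotientGroup.induction_on q fun _ => LinearMap.ext fun _ => Subtype.ext rfl⟩

/-- **`Y_V.V ≃ₗ[ℤ] X_V.V`**: the `↥W`-layer `(E_S|_W)^{V ∩ W}` has the same vectors as `(E_S|_U)^V` (`V ≤ W`; door-c6
`coe_traceLayer_mem_invariants` / `mem_invariants_traceLayer`) — the identity on vectors, as a linear equivalence for the
modules' own (`Rep.hV2`) structures (inverse to door-c4's `traceLayerHom W V M`). [cite: SerreGaloisCohomology1997, I §2.2 Prop. 8] -/
def traceLayerModuleEquiv :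
    letI := ((invariantsQuotFunctor ℤ
        (traceOpenNormalSubgroup
          ((OpenSubgroupLayer.layerSubgroup S hHo E hF hS : OpenNormalSubgroup ↥(galoisGroupAbove S H)) :
        Subgroup ↥(galoisGroupAbove S H))
          (OpenSubgroupLayer.layerSubgroup S hHo E' (hF.trans hEE') hS') :
          Subgroup ↥((OpenSubgroupLayer.layerSubgroup S hHo E hF hS : OpenNormalSubgroup ↥(galoisGroupAbove S H)) :
        Subgroup ↥(galoisGroupAbove S H)))).obj
      ((DiscreteRep.resD ℤ
        ((OpenSubgroupLayer.layerSubgroup S hHo E hF hS : OpenNormalSubgroup ↥(galoisGroupAbove S H)) :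
        Subgroup ↥(galoisGroupAbove S H))).obj
      (resD K S H hHo))).hV2
    letI := (layerRep hHo E' (hF.trans hEE') hS').hV2
    ((invariantsQuotFunctor ℤ
        (traceOpenNormalSubgroup
          ((OpenSubgroupLayer.layerSubgroup S hHo E hF hS : OpenNormalSubgroup ↥(galoisGroupAbove S H)) :
        Subgroup ↥(galoisGroupAbove S H))
          (OpenSubgroupLayer.layerSubgroup S hHo E' (hF.trans hEE') hS') :
          Subgroup ↥((OpenSubgroupLayer.layerSubgroup S hHo E hF hS : OpenNormalSubgroup ↥(galoisGroupAbove S H)) :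
        Subgroup ↥(galoisGroupAbove S H)))).obj
      ((DiscreteRep.resD ℤ
        ((OpenSubgroupLayer.layerSubgroup S hHo E hF hS : OpenNormalSubgroup ↥(galoisGroupAbove S H)) :
        Subgroup ↥(galoisGroupAbove S H))).obj
      (resD K S H hHo))).V ≃ₗ[ℤ]
      (layerRep hHo E' (hF.trans hEE') hS').V :=
  letI := ((invariantsQuotFunctor ℤ
        (traceOpenNormalSubgroup
          ((OpenSubgroupLayer.layerSubgroup S hHo E hF hS : OpenNormalSubgroup ↥(galoisGroupAbove S H)) :
        Subgroup ↥(galoisGroupAbove S H))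
          (OpenSubgroupLayer.layerSubgroup S hHo E' (hF.trans hEE') hS') :
          Subgroup ↥((OpenSubgroupLayer.layerSubgroup S hHo E hF hS : OpenNormalSubgroup ↥(galoisGroupAbove S H)) :
        Subgroup ↥(galoisGroupAbove S H)))).obj
      ((DiscreteRep.resD ℤ
        ((OpenSubgroupLayer.layerSubgroup S hHo E hF hS : OpenNormalSubgroup ↥(galoisGroupAbove S H)) :
        Subgroup ↥(galoisGroupAbove S H))).obj
      (resD K S H hHo))).hV2
  letI := (layerRep hHo E' (hF.trans hEE') hS').hV2
  { toFun := fun x => ⟨x.1, coe_traceLayer_mem_invariants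
        ((OpenSubgroupLayer.layerSubgroup S hHo E hF hS : OpenNormalSubgroup ↥(galoisGroupAbove S H)) :
        Subgroup ↥(galoisGroupAbove S H))
        (OpenSubgroupLayer.layerSubgroup S hHo E' (hF.trans hEE') hS') (resD K S H hHo) (layerSubgroup_le_of_le S hHo hEE' hF hS hS') x⟩
    invFun := fun y => ⟨y.1, mem_invariants_traceLayer
        ((OpenSubgroupLayer.layerSubgroup S hHo E hF hS : OpenNormalSubgroup ↥(galoisGroupAbove S H)) :
        Subgroup ↥(galoisGroupAbove S H))
        (OpenSubgroupLayer.layerSubgroup S hHo E' (hF.trans hEE') hS') (resD K S H hHo) y.1 y.2⟩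
    map_add' := fun _ _ => rfl
    map_smul' := fun _ _ => rfl
    left_inv := fun _ => rfl
    right_inv := fun _ => rfl }

/-- `traceLayerHom (traceLayerModuleEquiv x) = x`. [cite: SerreGaloisCohomology1997, I §2.2 Prop. 8] -/
theorem traceLayerHom_traceLayerModuleEquiv
    (x : ((invariantsQuotFunctor ℤ
        (traceOpenNormalSubgroup
          ((OpenSubgroupLayer.layerSubgroup S hHo E hF hS : OpenNormalSubgroup ↥(galoisGroupAbove S H)) :
        Subgroup ↥(galoisGroupAbove S H))
          (OpenSubgroupLayer.layerSubgroup S hHo E' (hF.trans hEE') hS') :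
          Subgroup ↥((OpenSubgroupLayer.layerSubgroup S hHo E hF hS : OpenNormalSubgroup ↥(galoisGroupAbove S H)) :
        Subgroup ↥(galoisGroupAbove S H)))).obj
      ((DiscreteRep.resD ℤ
        ((OpenSubgroupLayer.layerSubgroup S hHo E hF hS : OpenNormalSubgroup ↥(galoisGroupAbove S H)) :
        Subgroup ↥(galoisGroupAbove S H))).obj
      (resD K S H hHo))).V) :
    (traceLayerHom
      ((OpenSubgroupLayer.layerSubgroup S hHo E hF hS : OpenNormalSubgroup ↥(galoisGroupAbove S H)) :
        Subgroup ↥(galoisGroupAbove S H))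
      (OpenSubgroupLayer.layerSubgroup S hHo E' (hF.trans hEE') hS') (resD K S H hHo)).hom
      (traceLayerModuleEquiv hHo hEE' hF hS hS' x) = x :=
  Subtype.ext rfl

/-- `traceLayerModuleEquiv (traceLayerHom y) = y`. [cite: SerreGaloisCohomology1997, I §2.2 Prop. 8] -/
theorem traceLayerModuleEquiv_traceLayerHom
    (y : (layerRep hHo E' (hF.trans hEE') hS').V) :
    traceLayerModuleEquiv hHo hEE' hF hS hS'
      ((traceLayerHom
        ((OpenSubgroupLayer.layerSubgroup S hHo E hF hS : OpenNormalSubgroup ↥(galoisGroupAbove S H)) :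
        Subgroup ↥(galoisGroupAbove S H))
        (OpenSubgroupLayer.layerSubgroup S hHo E' (hF.trans hEE') hS') (resD K S H hHo)).hom y) = y :=
  Subtype.ext rfl

/-- `traceLayerModuleEquiv` is the identity on underlying units of `K̄`. [cite: NeukirchSchmidtWingberg2008, VIII §3] -/
theorem unitOf_traceLayerModuleEquiv
    (x : ((invariantsQuotFunctor ℤ
        (traceOpenNormalSubgroup
          ((OpenSubgroupLayer.layerSubgroup S hHo E hF hS : OpenNormalSubgroup ↥(galoisGroupAbove S H)) :
        Subgroup ↥(galoisGroupAbove S H))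
          (OpenSubgroupLayer.layerSubgroup S hHo E' (hF.trans hEE') hS') :
          Subgroup ↥((OpenSubgroupLayer.layerSubgroup S hHo E hF hS : OpenNormalSubgroup ↥(galoisGroupAbove S H)) :
        Subgroup ↥(galoisGroupAbove S H)))).obj
      ((DiscreteRep.resD ℤ
        ((OpenSubgroupLayer.layerSubgroup S hHo E hF hS : OpenNormalSubgroup ↥(galoisGroupAbove S H)) :
        Subgroup ↥(galoisGroupAbove S H))).obj
      (resD K S H hHo))).V) :
    unitOf (K := K) (S := S) (traceLayerModuleEquiv hHo hEE' hF hS hS' x).1 = unitOf (K := K) (S := S) x.1 :=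
  rfl

/-- **Equivariance**: `traceLayerModuleEquiv ([w] • x) = [w] • traceLayerModuleEquiv x` (`w ∈ W`, classes in `↥W ⧸ (V ∩ W)` and
`U ⧸ V`; both sides are `w • x` on vectors). [cite: SerreGaloisCohomology1997, I §2.2 Prop. 8] -/
theorem traceLayerModuleEquiv_ρ
    (w : ↥((OpenSubgroupLayer.layerSubgroup S hHo E hF hS : OpenNormalSubgroup ↥(galoisGroupAbove S H)) :
        Subgroup ↥(galoisGroupAbove S H)))
    (x : ((invariantsQuotFunctor ℤ
        (traceOpenNormalSubgroup
          ((OpenSubgroupLayer.layerSubgroup S hHo E hF hS : OpenNormalSubgroup ↥(galoisGroupAbove S H)) :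
        Subgroup ↥(galoisGroupAbove S H))
          (OpenSubgroupLayer.layerSubgroup S hHo E' (hF.trans hEE') hS') :
          Subgroup ↥((OpenSubgroupLayer.layerSubgroup S hHo E hF hS : OpenNormalSubgroup ↥(galoisGroupAbove S H)) :
        Subgroup ↥(galoisGroupAbove S H)))).obj
      ((DiscreteRep.resD ℤ
        ((OpenSubgroupLayer.layerSubgroup S hHo E hF hS : OpenNormalSubgroup ↥(galoisGroupAbove S H)) :
        Subgroup ↥(galoisGroupAbove S H))).obj
      (resD K S H hHo))).V) :
    traceLayerModuleEquiv hHo hEE' hF hS hS' (((invariantsQuotFunctor ℤ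
        (traceOpenNormalSubgroup
          ((OpenSubgroupLayer.layerSubgroup S hHo E hF hS : OpenNormalSubgroup ↥(galoisGroupAbove S H)) :
        Subgroup ↥(galoisGroupAbove S H))
          (OpenSubgroupLayer.layerSubgroup S hHo E' (hF.trans hEE') hS') :
          Subgroup ↥((OpenSubgroupLayer.layerSubgroup S hHo E hF hS : OpenNormalSubgroup ↥(galoisGroupAbove S H)) :
        Subgroup ↥(galoisGroupAbove S H)))).obj
      ((DiscreteRep.resD ℤ
        ((OpenSubgroupLayer.layerSubgroup S hHo E hF hS : OpenNormalSubgroup ↥(galoisGroupAbove S H)) :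
        Subgroup ↥(galoisGroupAbove S H))).obj
      (resD K S H hHo))).ρ (QuotientGroup.mk w) x) =
      (layerRep hHo E' (hF.trans hEE') hS').ρ (QuotientGroup.mk (w : ↥(galoisGroupAbove S H)))
        (traceLayerModuleEquiv hHo hEE' hF hS hS' x) :=
  Subtype.ext rfl

/-- The equivariance hypothesis of `mapIso` for `J′`: `(layerModuleEquiv ∘ traceLayerModuleEquiv) ∘ (q • ·) =
(traceEquiv q • ·) ∘ (layerModuleEquiv ∘ traceLayerModuleEquiv)` on `Y_V`. [cite: NeukirchSchmidtWingberg2008, VIII §3] -/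
theorem layerModuleEquiv_comm_traceEquiv
    (q : ↥((OpenSubgroupLayer.layerSubgroup S hHo E hF hS : OpenNormalSubgroup ↥(galoisGroupAbove S H)) :
        Subgroup ↥(galoisGroupAbove S H)) ⧸
      (traceOpenNormalSubgroup
        ((OpenSubgroupLayer.layerSubgroup S hHo E hF hS : OpenNormalSubgroup ↥(galoisGroupAbove S H)) :
        Subgroup ↥(galoisGroupAbove S H))
        (OpenSubgroupLayer.layerSubgroup S hHo E' (hF.trans hEE') hS') :
        Subgroup ↥((OpenSubgroupLayer.layerSubgroup S hHo E hF hS : OpenNormalSubgroup ↥(galoisGroupAbove S H)) :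
        Subgroup ↥(galoisGroupAbove S H)))) :
    letI := algOfLE hF
    letI := algOfLE (show E.1 ≤ E'.1 from hEE')
    letI := algOfLE (hF.trans hEE')
    haveI := isScalarTower_algOfLE (K := K) (show E.1 ≤ E'.1 from hEE')
    haveI := isScalarTower_algOfLE (K := K) (hF.trans hEE')
    letI := ((invariantsQuotFunctor ℤ
        (traceOpenNormalSubgroup
          ((OpenSubgroupLayer.layerSubgroup S hHo E hF hS : OpenNormalSubgroup ↥(galoisGroupAbove S H)) :
        Subgroup ↥(galoisGroupAbove S H))
          (OpenSubgroupLayer.layerSubgroup S hHo E' (hF.trans hEE') hS') :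
          Subgroup ↥((OpenSubgroupLayer.layerSubgroup S hHo E hF hS : OpenNormalSubgroup ↥(galoisGroupAbove S H)) :
        Subgroup ↥(galoisGroupAbove S H)))).obj
      ((DiscreteRep.resD ℤ
        ((OpenSubgroupLayer.layerSubgroup S hHo E hF hS : OpenNormalSubgroup ↥(galoisGroupAbove S H)) :
        Subgroup ↥(galoisGroupAbove S H))).obj
      (resD K S H hHo))).hV2
    letI := (layerRep hHo E' (hF.trans hEE') hS').hV2
    ((traceLayerModuleEquiv hHo hEE' hF hS hS').trans (layerModuleEquiv hHo E' (hF.trans hEE') hS')).toLinearMap ∘ₗ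
        ((invariantsQuotFunctor ℤ
        (traceOpenNormalSubgroup
          ((OpenSubgroupLayer.layerSubgroup S hHo E hF hS : OpenNormalSubgroup ↥(galoisGroupAbove S H)) :
        Subgroup ↥(galoisGroupAbove S H))
          (OpenSubgroupLayer.layerSubgroup S hHo E' (hF.trans hEE') hS') :
          Subgroup ↥((OpenSubgroupLayer.layerSubgroup S hHo E hF hS : OpenNormalSubgroup ↥(galoisGroupAbove S H)) :
        Subgroup ↥(galoisGroupAbove S H)))).obj
      ((DiscreteRep.resD ℤ
        ((OpenSubgroupLayer.layerSubgroup S hHo E hF hS : OpenNormalSubgroup ↥(galoisGroupAbove S H)) :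
        Subgroup ↥(galoisGroupAbove S H))).obj
      (resD K S H hHo))).ρ q =
      (sUnitsRep K S ↥E.1 ↥E'.1).ρ (traceEquiv hHo hEE' hF hS hS' q) ∘ₗ
        ((traceLayerModuleEquiv hHo hEE' hF hS hS').trans (layerModuleEquiv hHo E' (hF.trans hEE') hS')).toLinearMap := by
  letI := algOfLE hF
  letI := algOfLE (show E.1 ≤ E'.1 from hEE')
  letI := algOfLE (hF.trans hEE')
  haveI := isScalarTower_algOfLE (K := K) (show E.1 ≤ E'.1 from hEE')
  haveI := isScalarTower_algOfLE (K := K) (hF.trans hEE')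
  induction q using QuotientGroup.induction_on with
  | H w =>
    refine LinearMap.ext fun x => ?_
    simp only [LinearMap.coe_comp, Function.comp_apply, LinearEquiv.coe_coe, LinearEquiv.trans_apply]
    rw [traceLayerModuleEquiv_ρ hHo hEE' hF hS hS' w x, sUnitsRep_ρ_traceEquiv_mk hHo hEE' hF hS hS' w]
    exact LinearMap.congr_fun (layerModuleEquiv_comm hHo E' (hF.trans hEE') hS'
      (QuotientGroup.mk (w : ↥(galoisGroupAbove S H)))) _

/-- **`J′ : Hⁿ(↥W ⧸ (V ∩ W), Y_V) ≅ Hⁿ(Gal(E′/E), 𝒪_{E′,S}ˣ)`** — the layers of door-c4's colimit theorem for the open subgroup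
`↥W = Gal(K_S/E)` with coefficients `E_S|_W`, at the cofinal family `V ∩ W`, `V = Gal(K_S/E′)` (`E′ ≥ E`), ARE NSW's
`Hⁿ(Gal(E′/E), 𝒪_{E′,S}ˣ)` (Mathlib `mapIso` along `traceEquiv` and `traceLayerModuleEquiv ≫ layerModuleEquiv`).
[cite: NeukirchSchmidtWingberg2008, VIII §3 (8.3.11)] [cite: SerreGaloisCohomology1997, I §2.2 Prop. 8] -/
def traceLayerCohomologyIso (n : ℕ) :
    letI := algOfLE (show E.1 ≤ E'.1 from hEE')
    haveI := isScalarTower_algOfLE (K := K) (show E.1 ≤ E'.1 from hEE')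
    groupCohomology ((invariantsQuotFunctor ℤ
        (traceOpenNormalSubgroup
          ((OpenSubgroupLayer.layerSubgroup S hHo E hF hS : OpenNormalSubgroup ↥(galoisGroupAbove S H)) :
        Subgroup ↥(galoisGroupAbove S H))
          (OpenSubgroupLayer.layerSubgroup S hHo E' (hF.trans hEE') hS') :
          Subgroup ↥((OpenSubgroupLayer.layerSubgroup S hHo E hF hS : OpenNormalSubgroup ↥(galoisGroupAbove S H)) :
        Subgroup ↥(galoisGroupAbove S H)))).obj
      ((DiscreteRep.resD ℤ
        ((OpenSubgroupLayer.layerSubgroup S hHo E hF hS : OpenNormalSubgroup ↥(galoisGroupAbove S H)) :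
        Subgroup ↥(galoisGroupAbove S H))).obj
      (resD K S H hHo))) n ≅
      groupCohomology (sUnitsRep K S ↥E.1 ↥E'.1) n :=
  letI := algOfLE hF
  letI := algOfLE (show E.1 ≤ E'.1 from hEE')
  letI := algOfLE (hF.trans hEE')
  haveI := isScalarTower_algOfLE (K := K) (show E.1 ≤ E'.1 from hEE')
  haveI := isScalarTower_algOfLE (K := K) (hF.trans hEE')
  letI := ((invariantsQuotFunctor ℤ
        (traceOpenNormalSubgroup
          ((OpenSubgroupLayer.layerSubgroup S hHo E hF hS : OpenNormalSubgroup ↥(galoisGroupAbove S H)) :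
        Subgroup ↥(galoisGroupAbove S H))
          (OpenSubgroupLayer.layerSubgroup S hHo E' (hF.trans hEE') hS') :
          Subgroup ↥((OpenSubgroupLayer.layerSubgroup S hHo E hF hS : OpenNormalSubgroup ↥(galoisGroupAbove S H)) :
        Subgroup ↥(galoisGroupAbove S H)))).obj
      ((DiscreteRep.resD ℤ
        ((OpenSubgroupLayer.layerSubgroup S hHo E hF hS : OpenNormalSubgroup ↥(galoisGroupAbove S H)) :
        Subgroup ↥(galoisGroupAbove S H))).obj
      (resD K S H hHo))).hV2
  letI := (layerRep hHo E' (hF.trans hEE') hS').hV2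
  groupCohomology.mapIso (traceEquiv hHo hEE' hF hS hS')
    ((traceLayerModuleEquiv hHo hEE' hF hS hS').trans (layerModuleEquiv hHo E' (hF.trans hEE') hS'))
    (layerModuleEquiv_comm_traceEquiv hHo hEE' hF hS hS') n

/-- The morphism of pairs `(Gal(E′/E), 𝒪_{E′,S}ˣ) → (↥W ⧸ (V ∩ W), Y_V)` behind `J′`.
[cite: NeukirchSchmidtWingberg2008, VIII §3] -/
def traceLayerPairHom :
    letI := algOfLE (show E.1 ≤ E'.1 from hEE')
    haveI := isScalarTower_algOfLE (K := K) (show E.1 ≤ E'.1 from hEE')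
    Rep.res ((traceEquiv hHo hEE' hF hS hS').symm : (E'.1 ≃ₐ[E.1] E'.1) →* ↥((OpenSubgroupLayer.layerSubgroup S hHo E hF hS : OpenNormalSubgroup ↥(galoisGroupAbove S H)) :
        Subgroup ↥(galoisGroupAbove S H)) ⧸
        (traceOpenNormalSubgroup
          ((OpenSubgroupLayer.layerSubgroup S hHo E hF hS : OpenNormalSubgroup ↥(galoisGroupAbove S H)) :
        Subgroup ↥(galoisGroupAbove S H))
          (OpenSubgroupLayer.layerSubgroup S hHo E' (hF.trans hEE') hS') :
          Subgroup ↥((OpenSubgroupLayer.layerSubgroup S hHo E hF hS : OpenNormalSubgroup ↥(galoisGroupAbove S H)) :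
        Subgroup ↥(galoisGroupAbove S H))))
        ((invariantsQuotFunctor ℤ
        (traceOpenNormalSubgroup
          ((OpenSubgroupLayer.layerSubgroup S hHo E hF hS : OpenNormalSubgroup ↥(galoisGroupAbove S H)) :
        Subgroup ↥(galoisGroupAbove S H))
          (OpenSubgroupLayer.layerSubgroup S hHo E' (hF.trans hEE') hS') :
          Subgroup ↥((OpenSubgroupLayer.layerSubgroup S hHo E hF hS : OpenNormalSubgroup ↥(galoisGroupAbove S H)) :
        Subgroup ↥(galoisGroupAbove S H)))).obj
      ((DiscreteRep.resD ℤ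
        ((OpenSubgroupLayer.layerSubgroup S hHo E hF hS : OpenNormalSubgroup ↥(galoisGroupAbove S H)) :
        Subgroup ↥(galoisGroupAbove S H))).obj
      (resD K S H hHo))) ⟶
      sUnitsRep K S ↥E.1 ↥E'.1 :=
  letI := algOfLE hF
  letI := algOfLE (show E.1 ≤ E'.1 from hEE')
  letI := algOfLE (hF.trans hEE')
  haveI := isScalarTower_algOfLE (K := K) (show E.1 ≤ E'.1 from hEE')
  haveI := isScalarTower_algOfLE (K := K) (hF.trans hEE')
  letI := ((invariantsQuotFunctor ℤ
        (traceOpenNormalSubgroup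
          ((OpenSubgroupLayer.layerSubgroup S hHo E hF hS : OpenNormalSubgroup ↥(galoisGroupAbove S H)) :
        Subgroup ↥(galoisGroupAbove S H))
          (OpenSubgroupLayer.layerSubgroup S hHo E' (hF.trans hEE') hS') :
          Subgroup ↥((OpenSubgroupLayer.layerSubgroup S hHo E hF hS : OpenNormalSubgroup ↥(galoisGroupAbove S H)) :
        Subgroup ↥(galoisGroupAbove S H)))).obj
      ((DiscreteRep.resD ℤ
        ((OpenSubgroupLayer.layerSubgroup S hHo E hF hS : OpenNormalSubgroup ↥(galoisGroupAbove S H)) :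
        Subgroup ↥(galoisGroupAbove S H))).obj
      (resD K S H hHo))).hV2
  letI := (layerRep hHo E' (hF.trans hEE') hS').hV2
  Rep.ofHom ⟨((traceLayerModuleEquiv hHo hEE' hF hS hS').trans (layerModuleEquiv hHo E' (hF.trans hEE') hS')).toLinearMap,
    fun h => by
      have he := layerModuleEquiv_comm_traceEquiv hHo hEE' hF hS hS' ((traceEquiv hHo hEE' hF hS hS').symm h)
      rwa [MulEquiv.apply_symm_apply] at he⟩

/-- `J′.hom = Hⁿ(traceEquiv⁻¹, traceLayerPairHom)` (unfolding `mapIso`). [cite: NeukirchSchmidtWingberg2008, VIII §3] -/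
theorem traceLayerCohomologyIso_hom_eq (n : ℕ) :
    letI := algOfLE (show E.1 ≤ E'.1 from hEE')
    haveI := isScalarTower_algOfLE (K := K) (show E.1 ≤ E'.1 from hEE')
    (traceLayerCohomologyIso hHo hEE' hF hS hS' n).hom =
      groupCohomology.map ((traceEquiv hHo hEE' hF hS hS').symm : (E'.1 ≃ₐ[E.1] E'.1) →* ↥((OpenSubgroupLayer.layerSubgroup S hHo E hF hS : OpenNormalSubgroup ↥(galoisGroupAbove S H)) :
        Subgroup ↥(galoisGroupAbove S H)) ⧸
        (traceOpenNormalSubgroup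
          ((OpenSubgroupLayer.layerSubgroup S hHo E hF hS : OpenNormalSubgroup ↥(galoisGroupAbove S H)) :
        Subgroup ↥(galoisGroupAbove S H))
          (OpenSubgroupLayer.layerSubgroup S hHo E' (hF.trans hEE') hS') :
          Subgroup ↥((OpenSubgroupLayer.layerSubgroup S hHo E hF hS : OpenNormalSubgroup ↥(galoisGroupAbove S H)) :
        Subgroup ↥(galoisGroupAbove S H))))
        (traceLayerPairHom hHo hEE' hF hS hS') n :=
  rfl

/-- **`Hⁿ(κ, λ′) ≫ J′ = J`** for -w2's `κ = traceQuotMapRange W V` and `λ′ = traceLayerHom'` (= -w2's `λ` up to the spelling of `M`; both composites are `Hⁿ` of one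
morphism of pairs `(Gal(E′/E), 𝒪_{E′,S}ˣ) → (W̄, X_V)`). [cite: SerreGaloisCohomology1997, I §2.2 Prop. 8] -/
theorem map_traceQuotMapRange_comp_traceLayerCohomologyIso_hom (n : ℕ) :
    letI := algOfLE (show E.1 ≤ E'.1 from hEE')
    haveI := isScalarTower_algOfLE (K := K) (show E.1 ≤ E'.1 from hEE')
    groupCohomology.map
          (ContinuousRep.traceQuotMapRange
            ((OpenSubgroupLayer.layerSubgroup S hHo E hF hS : OpenNormalSubgroup ↥(galoisGroupAbove S H)) :
        Subgroup ↥(galoisGroupAbove S H))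
            (OpenSubgroupLayer.layerSubgroup S hHo E' (hF.trans hEE') hS'))
          (traceLayerHom' hHo hEE' hF hS hS') n ≫
        (traceLayerCohomologyIso hHo hEE' hF hS hS' n).hom =
      (relLayerCohomologyIso hHo hEE' hF hS hS' n).hom := by
  letI := algOfLE hF
  letI := algOfLE (show E.1 ≤ E'.1 from hEE')
  letI := algOfLE (hF.trans hEE')
  haveI := isScalarTower_algOfLE (K := K) (show E.1 ≤ E'.1 from hEE')
  haveI := isScalarTower_algOfLE (K := K) (hF.trans hEE')
  rw [traceLayerCohomologyIso_hom_eq, relLayerCohomologyIso_hom_eq, ← groupCohomology.map_comp]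
  refine map_congr' ?_ _ _ (fun x => ?_) n
  · refine MonoidHom.ext fun σ => ?_
    apply (relEquiv S hHo hEE' hF hS hS').injective
    simp only [MonoidHom.comp_apply, MonoidHom.coe_coe, MulEquiv.apply_symm_apply]
    exact (traceEquiv hHo hEE' hF hS hS').apply_symm_apply σ
  · -- module maps: `layerModuleEquiv (traceLayerModuleEquiv (λ x)) = layerModuleEquiv x`
    change layerModuleEquiv hHo E' (hF.trans hEE') hS'
        (traceLayerModuleEquiv hHo hEE' hF hS hS' ((traceLayerHom' hHo hEE' hF hS hS').hom x)) =
      layerModuleEquiv hHo E' (hF.trans hEE') hS' x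
    exact congrArg (layerModuleEquiv hHo E' (hF.trans hEE') hS') (Subtype.ext rfl)

/-- **`J′ (Hⁿ(κ, λ′) z) = J z`**: transporting a class of `Hⁿ(W̄, X_V)` to the `↥W`-layer along `κ`, `λ′` (= -w2's `Hⁿ(κ, λ)` up to the spelling of `M`) and reading it in
`Hⁿ(Gal(E′/E), 𝒪_{E′,S}ˣ)` is reading it directly through `J`. [cite: SerreGaloisCohomology1997, I §2.2 Prop. 8] -/
theorem traceLayerCohomologyIso_hom_map_traceQuotMapRange (n : ℕ)
    (z : groupCohomology (_root_.Literature.Algebra.Homology.resSub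
      (((OpenSubgroupLayer.layerSubgroup S hHo E hF hS : OpenNormalSubgroup ↥(galoisGroupAbove S H)) :
        Subgroup ↥(galoisGroupAbove S H)).map
        (QuotientGroup.mk' ((OpenSubgroupLayer.layerSubgroup S hHo E' (hF.trans hEE') hS') : Subgroup ↥(galoisGroupAbove S H))))
      (layerRep hHo E' (hF.trans hEE') hS')) n) :
    letI := algOfLE (show E.1 ≤ E'.1 from hEE')
    haveI := isScalarTower_algOfLE (K := K) (show E.1 ≤ E'.1 from hEE')
    (traceLayerCohomologyIso hHo hEE' hF hS hS' n).hom.hom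
        ((groupCohomology.map
          (ContinuousRep.traceQuotMapRange
            ((OpenSubgroupLayer.layerSubgroup S hHo E hF hS : OpenNormalSubgroup ↥(galoisGroupAbove S H)) :
        Subgroup ↥(galoisGroupAbove S H))
            (OpenSubgroupLayer.layerSubgroup S hHo E' (hF.trans hEE') hS'))
          (traceLayerHom' hHo hEE' hF hS hS') n).hom z) =
      (relLayerCohomologyIso hHo hEE' hF hS hS' n).hom.hom z := by
  letI := algOfLE (show E.1 ≤ E'.1 from hEE')
  haveI := isScalarTower_algOfLE (K := K) (show E.1 ≤ E'.1 from hEE')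
  have h := congrArg (fun φ => φ.hom z) (map_traceQuotMapRange_comp_traceLayerCohomologyIso_hom hHo hEE' hF hS hS' n)
  simpa only [ModuleCat.hom_comp, LinearMap.comp_apply] using h

/-- **The transition square: `stepG (V′ ∩ W) (V″ ∩ W) ≫ J′_{E″} = J′_{E′} ≫ layerInf`** for `E ≤ E′ ≤ E″` (both composites
are `Hⁿ` of one morphism of pairs `(Gal(E″/E), 𝒪_{E″,S}ˣ) → (↥W ⧸ (V′ ∩ W), Y_{V′})`: the group maps agree because
`(traceEquiv_{E″} [w])|_{E′} = traceEquiv_{E′} [w]`, the module maps are `x ↦ x` on `K̄`-values).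
[cite: SerreGaloisCohomology1997, I §2.2 Prop. 8] [cite: NeukirchSchmidtWingberg2008, VIII §3 (8.3.11)] -/
theorem stepG_comp_traceLayerCohomologyIso_hom {E'' : GalLayer K} (hE'E'' : E' ≤ E'')
    (hS'' : ramificationSubgroup K S ≤ galFixing K E''.1) (n : ℕ) :
    letI := algOfLE (show E.1 ≤ E'.1 from hEE')
    letI := algOfLE (show E.1 ≤ E''.1 from hEE'.trans hE'E'')
    haveI := isScalarTower_algOfLE (K := K) (show E.1 ≤ E'.1 from hEE')
    haveI := isScalarTower_algOfLE (K := K) (show E.1 ≤ E''.1 from hEE'.trans hE'E'')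
    haveI := E'.isGalois
    stepG
          (traceOpenNormalSubgroup
            ((OpenSubgroupLayer.layerSubgroup S hHo E hF hS : OpenNormalSubgroup ↥(galoisGroupAbove S H)) :
        Subgroup ↥(galoisGroupAbove S H))
            (OpenSubgroupLayer.layerSubgroup S hHo E' (hF.trans hEE') hS'))
          (traceOpenNormalSubgroup
            ((OpenSubgroupLayer.layerSubgroup S hHo E hF hS : OpenNormalSubgroup ↥(galoisGroupAbove S H)) :
        Subgroup ↥(galoisGroupAbove S H))
            (OpenSubgroupLayer.layerSubgroup S hHo E'' (hF.trans (hEE'.trans hE'E'')) hS''))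
          (traceOpenNormalSubgroup_mono _ (layerSubgroup_le_of_le S hHo hE'E'' (hF.trans hEE') hS' hS''))
          ((DiscreteRep.resD ℤ
        ((OpenSubgroupLayer.layerSubgroup S hHo E hF hS : OpenNormalSubgroup ↥(galoisGroupAbove S H)) :
        Subgroup ↥(galoisGroupAbove S H))).obj
      (resD K S H hHo)) n ≫
        (traceLayerCohomologyIso hHo (hEE'.trans hE'E'') hF hS hS'' n).hom =
      (traceLayerCohomologyIso hHo hEE' hF hS hS' n).hom ≫
        layerInf S (show E.1 ≤ E'.1 from hEE') (show E'.1 ≤ E''.1 from hE'E'') n := by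
  letI := algOfLE hF
  letI := algOfLE (show E.1 ≤ E'.1 from hEE')
  letI := algOfLE (show E.1 ≤ E''.1 from hEE'.trans hE'E'')
  letI := algOfLE (show E'.1 ≤ E''.1 from hE'E'')
  letI := algOfLE (hF.trans hEE')
  letI := algOfLE (hF.trans (hEE'.trans hE'E''))
  haveI := isScalarTower_algOfLE (K := K) (show E.1 ≤ E'.1 from hEE')
  haveI := isScalarTower_algOfLE (K := K) (show E.1 ≤ E''.1 from hEE'.trans hE'E'')
  haveI := isScalarTower_algOfLE (K := K) (hF.trans hEE')
  haveI := isScalarTower_algOfLE (K := K) (hF.trans (hEE'.trans hE'E''))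
  haveI := E'.isGalois
  haveI := normal_algOfLE (K := K) (show E.1 ≤ E'.1 from hEE')
  haveI := isScalarTower_algOfLE₃ (show E.1 ≤ E'.1 from hEE') (show E'.1 ≤ E''.1 from hE'E'')
  rw [layerInf_eq_map, traceLayerCohomologyIso_hom_eq, traceLayerCohomologyIso_hom_eq, ← groupCohomology.map_comp,
    ← groupCohomology.map_comp]
  refine map_congr' ?_ _ _ (fun x => ?_) n
  · -- group homomorphisms `Gal(E″/E) → ↥W ⧸ (V′ ∩ W)`: both send `τ` to `[w]` when `traceEquiv_{E″} [w] = τ`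
    refine MonoidHom.ext fun τ => ?_
    obtain ⟨q, rfl⟩ := (traceEquiv hHo (hEE'.trans hE'E'') hF hS hS'').surjective τ
    induction q using QuotientGroup.induction_on with
    | H w =>
      simp only [MonoidHom.comp_apply, MonoidHom.coe_coe, MulEquiv.symm_apply_apply]
      rw [MulEquiv.eq_symm_apply]
      change traceEquiv hHo hEE' hF hS hS' (QuotientGroup.mk w) = _
      refine AlgEquiv.ext fun (y : ↥E'.1) => Subtype.ext ?_
      change ((layerEquiv S hHo E' (hF.trans hEE') hS' (QuotientGroup.mk (w : ↥(galoisGroupAbove S H))) y : ↥E'.1) :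
          AlgebraicClosure K) =
        (((traceEquiv hHo (hEE'.trans hE'E'') hF hS hS'' (QuotientGroup.mk w)).restrictNormal ↥E'.1 y : ↥E'.1) :
          AlgebraicClosure K)
      rw [coe_layerEquiv_mk_eq_of_le S hHo hE'E'' (hF.trans hEE') hS'' (w : ↥(galoisGroupAbove S H)) y]
      have h := AlgEquiv.restrictNormal_commutes
        (traceEquiv hHo (hEE'.trans hE'E'') hF hS hS'' (QuotientGroup.mk w)) ↥E'.1 y
      exact (congrArg (fun z : ↥E''.1 => (z : AlgebraicClosure K)) h).symm
  · -- module maps: both are `x ↦ x` on `K̄`-values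
    apply (Additive.toMul (α := sUnits K S ↥E''.1)).injective
    refine Subtype.ext (Units.ext (Subtype.ext ?_))
    refine (coe_layerModuleEquiv hHo E'' (hF.trans (hEE'.trans hE'E'')) hS'' _).trans ?_
    refine Eq.trans ?_ ((coe_layerInflHom S (show E.1 ≤ E'.1 from hEE') (show E'.1 ≤ E''.1 from hE'E'') _).trans
      (coe_layerModuleEquiv hHo E' (hF.trans hEE') hS' _)).symm
    rfl

/-- **Elementwise transition formula `J′_{E″} (stepG … z) = layerInf (J′_{E′} z)`** — the `compat` field of door-c4's
`LayerColimit.IsCompatibleFamily` for the family `E′ ↦ V_{E′} ∩ W` of layers of `↥W` and the maps `J′_{E′}` (followed by any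
additive map out of NSW's direct system, e.g. -w3's `invVec`). [cite: SerreGaloisCohomology1997, I §2.2 Prop. 8]
[cite: NeukirchSchmidtWingberg2008, VIII §3 (8.3.11)] -/
theorem traceLayerCohomologyIso_hom_stepG {E'' : GalLayer K} (hE'E'' : E' ≤ E'')
    (hS'' : ramificationSubgroup K S ≤ galFixing K E''.1) (n : ℕ)
    (z : groupCohomology ((invariantsQuotFunctor ℤ
        (traceOpenNormalSubgroup
          ((OpenSubgroupLayer.layerSubgroup S hHo E hF hS : OpenNormalSubgroup ↥(galoisGroupAbove S H)) :
        Subgroup ↥(galoisGroupAbove S H))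
          (OpenSubgroupLayer.layerSubgroup S hHo E' (hF.trans hEE') hS') :
          Subgroup ↥((OpenSubgroupLayer.layerSubgroup S hHo E hF hS : OpenNormalSubgroup ↥(galoisGroupAbove S H)) :
        Subgroup ↥(galoisGroupAbove S H)))).obj
      ((DiscreteRep.resD ℤ
        ((OpenSubgroupLayer.layerSubgroup S hHo E hF hS : OpenNormalSubgroup ↥(galoisGroupAbove S H)) :
        Subgroup ↥(galoisGroupAbove S H))).obj
      (resD K S H hHo))) n) :
    letI := algOfLE (show E.1 ≤ E'.1 from hEE')
    letI := algOfLE (show E.1 ≤ E''.1 from hEE'.trans hE'E'')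
    haveI := isScalarTower_algOfLE (K := K) (show E.1 ≤ E'.1 from hEE')
    haveI := isScalarTower_algOfLE (K := K) (show E.1 ≤ E''.1 from hEE'.trans hE'E'')
    haveI := E'.isGalois
    (traceLayerCohomologyIso hHo (hEE'.trans hE'E'') hF hS hS'' n).hom.hom
        (stepG
          (traceOpenNormalSubgroup
            ((OpenSubgroupLayer.layerSubgroup S hHo E hF hS : OpenNormalSubgroup ↥(galoisGroupAbove S H)) :
        Subgroup ↥(galoisGroupAbove S H))
            (OpenSubgroupLayer.layerSubgroup S hHo E' (hF.trans hEE') hS'))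
          (traceOpenNormalSubgroup
            ((OpenSubgroupLayer.layerSubgroup S hHo E hF hS : OpenNormalSubgroup ↥(galoisGroupAbove S H)) :
        Subgroup ↥(galoisGroupAbove S H))
            (OpenSubgroupLayer.layerSubgroup S hHo E'' (hF.trans (hEE'.trans hE'E'')) hS''))
          (traceOpenNormalSubgroup_mono _ (layerSubgroup_le_of_le S hHo hE'E'' (hF.trans hEE') hS' hS''))
          ((DiscreteRep.resD ℤ
        ((OpenSubgroupLayer.layerSubgroup S hHo E hF hS : OpenNormalSubgroup ↥(galoisGroupAbove S H)) :
        Subgroup ↥(galoisGroupAbove S H))).obj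
      (resD K S H hHo)) n z) =
      layerInf S (show E.1 ≤ E'.1 from hEE') (show E'.1 ≤ E''.1 from hE'E'') n
        ((traceLayerCohomologyIso hHo hEE' hF hS hS' n).hom.hom z) := by
  letI := algOfLE (show E.1 ≤ E'.1 from hEE')
  letI := algOfLE (show E.1 ≤ E''.1 from hEE'.trans hE'E'')
  haveI := isScalarTower_algOfLE (K := K) (show E.1 ≤ E'.1 from hEE')
  haveI := isScalarTower_algOfLE (K := K) (show E.1 ≤ E''.1 from hEE'.trans hE'E'')
  haveI := E'.isGalois
  have h := congrArg (fun φ => φ.hom z) (stepG_comp_traceLayerCohomologyIso_hom hHo hEE' hF hS hS' hE'E'' hS'' n)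
  simpa only [ModuleCat.hom_comp, LinearMap.comp_apply] using h

end Layers

end SUnits

end Literature.NumberTheory.GaloisRepresentations

end
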